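import Literature.NumberTheory.EllipticCurves.RealLatticePeriodDiscrProofs
import Literature.NumberTheory.Transcendental.KontsevichZagierEllipticLiftProofs

/-!
# `XMapKernel`, line `derived-datum-quasi-periods` — stub `stub_etaIndependence`, auxiliary file:
# the real quasi-period of a rectangular real lattice as an elliptic integral of the second kind

Support file for the crux `IsogenyCertificates.XMapKernel` (stmt-KontsevichZagierPeriods-10663),
line `derived-datum-quasi-periods`, stub `stub_etaIndependence` (the transcendence input of the
`(ω, η)`-egg cell). This file supplies the CLASSICAL half of that input which the tree lacked: the
companion, for the differential of the second kind `x dx/y`, of the tree's real-period formula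
`PeriodPair.IsReal.integral_inv_sqrt_cubic_of_discr_pos_eq` (Lawden (6.12.18)).

**Theorem (`integral_mul_inv_sqrt_cubic_of_discr_pos`).** Let `Λ` be a real lattice with real
invariants `g₂, g₃`, `f(x) = 4x³ − g₂x − g₃`, `g₂³ − 27g₃² > 0` (rectangular case: `f` has three
real roots `e₁ > e₂ > e₃`, `e₁ = ℘(Ω₀/2)`, `Ω₀` the least positive real period). Then
`∫_{e₃}^{e₂} x dx/√f(x) = −ζ_Λ(Ω₀/2)`, the domain `(e₃, e₂)` being written `{x < e₁ | f(x) > 0}`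
exactly as in the tree's `ω`-formula `∫_{e₃}^{e₂} dx/√f(x) = Ω₀/2`, and the identity being stated in
`ℂ` (its left-hand side is real). In other words the quasi-period `η(Ω₀) = 2ζ(Ω₀/2)` of the real
period `Ω₀ = 2∫_{e₃}^{e₂} dx/√f` is `−2∫_{e₃}^{e₂} x dx/√f` (Whittaker–Watson §20.41 `η = ζ(ω)`;
Lawden §6.12–§6.13 for the real rectangular lattice).

**Proof** (the tree's proof of the `ω`-formula, run with the integrand `x/√f`). Let `Ω₀'` be the
least positive real period of the real lattice `iΛ` and `w = iΩ₀'/2` (`2w ∈ Λ`, `w ∉ Λ`,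
`conj w = −w`). As in `PeriodPair.IsReal.integral_inv_sqrt_cubic_of_discr_pos_eq`, `disc f > 0`
excludes the rhombic case `w + Ω₀/2 ∈ Λ`, so the horizontal line `w + ℝ` misses `Λ`; on it `℘` and
`℘'` are real, `℘' ≠ 0` on `w + (0, Ω₀/2)`, and `t ↦ ℘(w + t)` maps `(0, Ω₀/2)` monotonically onto
the bounded component `(e₃, e₂) = {x < e₁ | f > 0}`. Substituting `x = ℘(w + t)`,
`dx = ℘'(w + t) dt`, `|℘'| = √f(x)`:
`∫_{e₃}^{e₂} x dx/√f(x) = ∫₀^{Ω₀/2} ℘(w + t) dt = ζ(w) − ζ(w + Ω₀/2)` (`ζ' = −℘`,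
`PeriodPair.deriv_weierstrassZeta_holds`, and the fundamental theorem of calculus), and
`ζ(w) − ζ(w + Ω₀/2) = −ζ(Ω₀/2)` by the values of `ζ` at half-lattice points,
`2ζ((mω₁ + nω₂)/2) = mη₁ + nη₂` (`two_mul_weierstrassZeta_half_lattice`), applied to `2w`,
`2w + Ω₀` and `Ω₀`. No definitions, no named facts.

References: D. F. Lawden, *Elliptic Functions and Applications* (Springer 1989), §6.11–§6.13,
eqs. (6.12.12)–(6.12.18); E. T. Whittaker, G. N. Watson, *A Course of Modern Analysis*, §20.32,
§20.41.
-/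

noncomputable section

open scoped ComplexConjugate Topology PeriodPair
open Filter Set MeasureTheory Complex

namespace Summit.KontsevichZagierPeriods.IsogenyCertificates.XMapKernelStubs.EtaIndependence

variable {L : PeriodPair} {w : ℂ}

/-- **The quasi-period along a bounded horizontal segment.** For a real lattice and a horizontal
line `w + ℝ` missing `Λ` with `2w ∈ Λ`, `conj w = −w`, the function `t ↦ ℘(w + t)` maps `(0, Ω₀/2)`
monotonically onto an interval `(m, M)` between two roots of `f = 4x³ − g₂x − g₃` with `f > 0`
inside, and, substituting `x = ℘(w + t)` (`|℘'| = √f`),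
`∫_m^M x dx/√f(x) = ∫₀^{Ω₀/2} ℘(w + t) dt = ζ(w) − ζ(w + Ω₀/2)` (`ζ' = −℘`; Whittaker–Watson §20.4,
Lawden (6.12.12)–(6.12.13) with the integrand of the second kind). [folklore] -/
theorem exists_Ioo_integral_mul_eq_of_line (h : L.IsReal) (h2w : 2 * w ∈ L.lattice)
    (hcw : conj w = -w) (hline : ∀ t : ℝ, w + t ∉ L.lattice) :
    ∃ m M : ℝ, m < M ∧ 4 * m ^ 3 - L.g₂.re * m - L.g₃.re = 0 ∧
      4 * M ^ 3 - L.g₂.re * M - L.g₃.re = 0 ∧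
      (∀ x ∈ Ioo m M, 0 < 4 * x ^ 3 - L.g₂.re * x - L.g₃.re) ∧
      (((∫ x in Ioo m M, x * (Real.sqrt (4 * x ^ 3 - L.g₂.re * x - L.g₃.re))⁻¹ : ℝ) : ℂ)) =
        L.weierstrassZeta w - L.weierstrassZeta (w + ((L.minRealPeriod / 2 : ℝ) : ℂ)) := by
  set T := L.minRealPeriod / 2 with hT
  have hT0 : 0 < T := by have := h.minRealPeriod_pos; positivity
  set φ : ℝ → ℝ := fun s ↦ (℘[L] (w + s)).re with hφ
  set ψ : ℝ → ℝ := fun s ↦ (℘'[L] (w + s)).re with hψ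
  set f : ℝ → ℝ := fun x ↦ 4 * x ^ 3 - L.g₂.re * x - L.g₃.re with hf
  have hder : ∀ s, HasDerivAt φ (ψ s) s := fun s ↦
    PeriodPair.hasDerivAt_weierstrassP_line_re (hline s)
  have hφc : Continuous φ := continuous_iff_continuousAt.mpr fun s ↦ (hder s).continuousAt
  have hψc : Continuous ψ := continuous_iff_continuousAt.mpr fun s ↦
    (PeriodPair.hasDerivAt_derivWeierstrassP_line_re (hline s)).continuousAt
  have hsq : ∀ s, ψ s ^ 2 = f (φ s) := fun s ↦ h.derivWeierstrassP_line_re_sq h2w hcw (hline s)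
  have hψne : ∀ s ∈ Ioo 0 T, ψ s ≠ 0 := by
    intro s hs h0
    refine h.derivWeierstrassP_line_ne_zero h2w (hline s) hs.1 hs.2 ?_
    exact Complex.ext (by simpa [hψ] using h0) (by simp [h.derivWeierstrassP_line_im h2w hcw s])
  have hψ0 : ψ 0 = 0 := by
    simp only [hψ, Complex.ofReal_zero, add_zero]
    rw [PeriodPair.derivWeierstrassP_eq_zero_of_two_mul_mem h2w, Complex.zero_re]
  have hψT : ψ T = 0 := by
    simp only [hψ]
    rw [PeriodPair.derivWeierstrassP_eq_zero_of_two_mul_mem, Complex.zero_re]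
    rw [show 2 * (w + ((T : ℝ) : ℂ)) = 2 * w + (L.minRealPeriod : ℂ) by
      rw [hT]; push_cast; ring]
    exact add_mem h2w h.minRealPeriod_mem_lattice
  have hf0 : f (φ 0) = 0 := by rw [← hsq, hψ0]; ring
  have hfT : f (φ T) = 0 := by rw [← hsq, hψT]; ring
  have hfpos : ∀ s ∈ Ioo 0 T, 0 < f (φ s) := fun s hs ↦ by
    rw [← hsq, sq]; exact mul_self_pos.mpr (hψne s hs)
  -- `ψ` has constant sign on `(0, T)`
  have hsign : (∀ s ∈ Ioo 0 T, 0 < ψ s) ∨ (∀ s ∈ Ioo 0 T, ψ s < 0) := by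
    by_contra hcon
    push Not at hcon
    obtain ⟨⟨a, ha, hψa⟩, ⟨b, hb, hψb⟩⟩ := hcon
    have hψa' : ψ a < 0 := lt_of_le_of_ne hψa (hψne a ha)
    have hψb' : 0 < ψ b := lt_of_le_of_ne hψb (hψne b hb).symm
    have hsub : uIcc a b ⊆ Ioo 0 T := ordConnected_Ioo.uIcc_subset ha hb
    obtain ⟨c, hc, hψc0⟩ := intermediate_value_uIcc (hψc.continuousOn (s := uIcc a b))
      (mem_uIcc.mpr (Or.inl ⟨hψa'.le, hψb'.le⟩))
    exact hψne c (hsub hc) hψc0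
  -- `℘` is real on the line
  have hP : ∀ s : ℝ, ((φ s : ℝ) : ℂ) = ℘[L] (w + s) := fun s ↦
    Complex.ext (by simp [hφ]) (by simp [h.weierstrassP_line_im h2w hcw s])
  -- the fundamental theorem of calculus for `ζ' = -℘` along the line
  have hFTC : ∫ s in (0 : ℝ)..T, ℘[L] (w + s) =
      L.weierstrassZeta w - L.weierstrassZeta (w + ((T : ℝ) : ℂ)) := by
    have hopen : IsOpen ((L.lattice : Set ℂ)ᶜ) := L.isClosed_lattice.isOpen_compl
    have hderζ : ∀ s : ℝ,
        HasDerivAt (fun t : ℝ ↦ L.weierstrassZeta (w + t)) (-℘[L] (w + s)) s := by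
      intro s
      have hd : DifferentiableAt ℂ L.weierstrassZeta (w + s) :=
        L.differentiableOn_weierstrassZeta_holds.differentiableAt (hopen.mem_nhds (hline s))
      have hζ : HasDerivAt L.weierstrassZeta (-℘[L] (w + s)) (w + s) := by
        rw [← L.deriv_weierstrassZeta_holds (w + s) (hline s)]
        exact hd.hasDerivAt
      exact (hζ.comp_const_add w s).comp_ofReal
    have hcont : Continuous fun s : ℝ ↦ ℘[L] (w + s) := by
      have e : (fun s : ℝ ↦ ℘[L] (w + s)) = fun s ↦ ((φ s : ℝ) : ℂ) :=
        funext fun s ↦ (hP s).symm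
      rw [e]
      exact Complex.continuous_ofReal.comp hφc
    have key := intervalIntegral.integral_eq_sub_of_hasDerivAt (fun s _ ↦ hderζ s)
      (hcont.neg.intervalIntegrable 0 T)
    rw [intervalIntegral.integral_neg] at key
    simp only [Complex.ofReal_zero, add_zero] at key
    linear_combination -key
  -- hence `∫_{(0,T)} re ℘(w + s) ds = ζ(w) - ζ(w + T)`
  have hIoo : ((∫ s in Ioo 0 T, φ s : ℝ) : ℂ) =
      L.weierstrassZeta w - L.weierstrassZeta (w + ((T : ℝ) : ℂ)) := by
    rw [← integral_Ioc_eq_integral_Ioo, ← intervalIntegral.integral_of_le hT0.le,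
      ← intervalIntegral.integral_ofReal, ← hFTC]
    exact intervalIntegral.integral_congr fun s _ ↦ hP s
  -- the change of variables `x = ℘(w + t)`
  have hcv : ∀ _ : InjOn φ (Ioo 0 T),
      ∫ x in φ '' Ioo 0 T, x * (Real.sqrt (f x))⁻¹ = ∫ s in Ioo 0 T, φ s := by
    intro hinj
    rw [integral_image_eq_integral_abs_deriv_smul measurableSet_Ioo
      (fun s _ ↦ (hder s).hasDerivWithinAt) hinj]
    refine setIntegral_congr_fun measurableSet_Ioo fun s hs ↦ ?_
    simp only [smul_eq_mul]
    have hψabs : |ψ s| = Real.sqrt (f (φ s)) := by rw [← hsq s, Real.sqrt_sq_eq_abs]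
    rw [← hψabs]
    field_simp [abs_ne_zero.mpr (hψne s hs)]
  rcases hsign with hpos | hneg
  · have hmono : StrictMonoOn φ (Icc 0 T) := by
      refine strictMonoOn_of_deriv_pos (convex_Icc 0 T) hφc.continuousOn fun s hs ↦ ?_
      rw [interior_Icc] at hs
      rw [(hder s).deriv]
      exact hpos s hs
    have himage : φ '' Ioo 0 T = Ioo (φ 0) (φ T) := by
      refine Subset.antisymm ?_ (intermediate_value_Ioo hT0.le hφc.continuousOn)
      rintro _ ⟨s, hs, rfl⟩
      exact ⟨hmono (left_mem_Icc.mpr hT0.le) (Ioo_subset_Icc_self hs) hs.1,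
        hmono (Ioo_subset_Icc_self hs) (right_mem_Icc.mpr hT0.le) hs.2⟩
    refine ⟨φ 0, φ T, hmono (left_mem_Icc.mpr hT0.le) (right_mem_Icc.mpr hT0.le) hT0, hf0, hfT,
      ?_, ?_⟩
    · intro x hx
      rw [← himage] at hx
      obtain ⟨s, hs, rfl⟩ := hx
      exact hfpos s hs
    · rw [← himage, hcv (hmono.injOn.mono Ioo_subset_Icc_self), hIoo]
  · have hanti : StrictAntiOn φ (Icc 0 T) := by
      refine strictAntiOn_of_deriv_neg (convex_Icc 0 T) hφc.continuousOn fun s hs ↦ ?_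
      rw [interior_Icc] at hs
      rw [(hder s).deriv]
      exact hneg s hs
    have himage : φ '' Ioo 0 T = Ioo (φ T) (φ 0) := by
      refine Subset.antisymm ?_ (intermediate_value_Ioo' hT0.le hφc.continuousOn)
      rintro _ ⟨s, hs, rfl⟩
      exact ⟨hanti (Ioo_subset_Icc_self hs) (right_mem_Icc.mpr hT0.le) hs.2,
        hanti (left_mem_Icc.mpr hT0.le) (Ioo_subset_Icc_self hs) hs.1⟩
    refine ⟨φ T, φ 0, hanti (left_mem_Icc.mpr hT0.le) (right_mem_Icc.mpr hT0.le) hT0, hfT, hf0,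
      ?_, ?_⟩
    · intro x hx
      rw [← himage] at hx
      obtain ⟨s, hs, rfl⟩ := hx
      exact hfpos s hs
    · rw [← himage, hcv (hanti.injOn.mono Ioo_subset_Icc_self), hIoo]

/-- **The bounded component is `(m, M)`.** For a real lattice with `g₂³ − 27g₃² > 0`, an interval
`(m, M)` between two roots `m < M` of `f = 4x³ − g₂x − g₃` on which `f > 0` is the bounded
component `{x < e₁ | f(x) > 0}`, `e₁ = ℘(Ω₀/2)`: `f > 0` beyond `e₁` (`IsReal.cubic_pos_of_lt`) gives
`M ≤ e₁`, `M = e₁` would make `e₁` a double root (`disc f = (g₂ − 3e₁²)(12e₁² − g₂)² ≠ 0`), so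
`m < M < e₁` are the three roots (the tail of the tree's proof of
`PeriodPair.IsReal.integral_inv_sqrt_cubic_of_discr_pos_eq`). [folklore] -/
theorem setOf_cubic_pos_lt_eq_Ioo_of_roots (h : L.IsReal)
    (hdisc : 0 < L.g₂.re ^ 3 - 27 * L.g₃.re ^ 2) {m M : ℝ} (hmM : m < M)
    (hfm : 4 * m ^ 3 - L.g₂.re * m - L.g₃.re = 0) (hfM : 4 * M ^ 3 - L.g₂.re * M - L.g₃.re = 0)
    (hfpos : ∀ x ∈ Ioo m M, 0 < 4 * x ^ 3 - L.g₂.re * x - L.g₃.re) :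
    {x : ℝ | 0 < 4 * x ^ 3 - L.g₂.re * x - L.g₃.re ∧
        x < L.weierstrassPRe (L.minRealPeriod / 2)} = Ioo m M := by
  set e₁ := L.weierstrassPRe (L.minRealPeriod / 2) with he₁_def
  have he₁ : 4 * e₁ ^ 3 - L.g₂.re * e₁ - L.g₃.re = 0 := h.cubic_weierstrassPRe_half
  have hright : ∀ x, e₁ < x → 0 < 4 * x ^ 3 - L.g₂.re * x - L.g₃.re :=
    fun x hx ↦ h.cubic_pos_of_lt hx
  have h12 : 12 * e₁ ^ 2 - L.g₂.re ≠ 0 := by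
    intro h0
    rw [PeriodPair.cubic_discr_eq_of_root he₁, h0] at hdisc
    simp at hdisc
  have hMe : M ≤ e₁ := by
    by_contra hcon
    push Not at hcon
    have := hright M hcon
    rw [hfM] at this
    exact lt_irrefl 0 this
  have hMne : M ≠ e₁ := by
    intro hMe₁
    apply h12
    exact PeriodPair.twelve_mul_sq_sub_eq_zero he₁ (m := m) (by rw [← hMe₁]; exact hmM)
      (fun x hx ↦ hfpos x (by rw [hMe₁]; exact hx)) hright
  have hMlt : M < e₁ := lt_of_le_of_ne hMe hMne
  have hme : m ≠ e₁ := (hmM.trans hMlt).ne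
  have hprod := PeriodPair.cubic_eq_prod_of_roots hmM.ne hme hMne hfm hfM he₁
  exact PeriodPair.setOf_cubic_pos_lt_eq_Ioo hmM hMlt hprod

/-- **Values of `ζ` at the half-periods of the segment**: if `2w ∈ Λ` then
`ζ(w) − ζ(w + Ω₀/2) = −ζ(Ω₀/2)` (write `2w = cω₁ + dω₂`, `Ω₀ = aω₁ + bω₂` and use
`2ζ((mω₁ + nω₂)/2) = mη₁ + nη₂`, Whittaker–Watson §20.41; classically `ζ(ω + ω') − ζ(ω') = η`).
[folklore] -/
theorem weierstrassZeta_sub_weierstrassZeta_add_half (h : L.IsReal) (h2w : 2 * w ∈ L.lattice) :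
    L.weierstrassZeta w - L.weierstrassZeta (w + ((L.minRealPeriod / 2 : ℝ) : ℂ)) =
      -L.weierstrassZeta ((L.minRealPeriod / 2 : ℝ) : ℂ) := by
  obtain ⟨c, d, hcd⟩ := PeriodPair.mem_lattice.1 h2w
  obtain ⟨a, b, hab⟩ := PeriodPair.mem_lattice.1 h.minRealPeriod_mem_lattice
  have e4 : ((L.minRealPeriod / 2 : ℝ) : ℂ) = (L.minRealPeriod : ℂ) / 2 := by push_cast; ring
  rw [e4]
  have h1 := Literature.NumberTheory.Transcendental.two_mul_weierstrassZeta_half_lattice L c d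
  have h2 := Literature.NumberTheory.Transcendental.two_mul_weierstrassZeta_half_lattice L
    (a + c) (b + d)
  have h3 := Literature.NumberTheory.Transcendental.two_mul_weierstrassZeta_half_lattice L a b
  have e1 : ((c : ℂ) * L.ω₁ + d * L.ω₂) / 2 = w := by rw [hcd]; ring
  have e2 : (((a + c : ℤ) : ℂ) * L.ω₁ + ((b + d : ℤ) : ℂ) * L.ω₂) / 2 =
      w + (L.minRealPeriod : ℂ) / 2 := by
    push_cast
    rw [show ((a : ℂ) + c) * L.ω₁ + ((b : ℂ) + d) * L.ω₂ =
      ((a : ℂ) * L.ω₁ + b * L.ω₂) + ((c : ℂ) * L.ω₁ + d * L.ω₂) by ring, hab, hcd]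
    ring
  have e3 : ((a : ℂ) * L.ω₁ + b * L.ω₂) / 2 = (L.minRealPeriod : ℂ) / 2 := by rw [hab]
  rw [e1] at h1
  rw [e2] at h2
  rw [e3] at h3
  push_cast at h2
  linear_combination (h1 - h2 + h3) / 2

/-- **The real quasi-period as an elliptic integral of the second kind over the bounded real
component** (Lawden 1989, §6.12–§6.13; Whittaker–Watson §20.41): for a real lattice with
`g₂³ − 27g₃² > 0` (three real roots `e₁ > e₂ > e₃` of `f = 4x³ − g₂x − g₃`, `e₁ = ℘(Ω₀/2)`),
`∫_{e₃}^{e₂} x dx/√f(x) = −ζ(Ω₀/2)`, i.e. `η(Ω₀) = 2ζ(Ω₀/2) = −2∫_{e₃}^{e₂} x dx/√f`; the domain is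
written `{x < e₁ | f(x) > 0}` as in `PeriodPair.IsReal.integral_inv_sqrt_cubic_of_discr_pos_eq`
and the identity is stated in `ℂ`. Proof in the module docstring (the rotated lattice `iΛ`, the
line `w + ℝ` through the imaginary half-period, `exists_Ioo_integral_mul_eq_of_line`,
`setOf_cubic_pos_lt_eq_Ioo_of_roots`, `weierstrassZeta_sub_weierstrassZeta_add_half`).
[cite: Lawden1989, §6.12 eqs. (6.12.12)–(6.12.18) and §6.13] -/
theorem integral_mul_inv_sqrt_cubic_of_discr_pos : ∀ (L : PeriodPair), L.IsReal → 0 < L.g₂.re ^ 3 - 27 * L.g₃.re ^ 2 → (((∫ x in {x : ℝ | 0 < 4 * x ^ 3 - L.g₂.re * x - L.g₃.re ∧ x < L.weierstrassPRe (L.minRealPeriod / 2)}, x * (Real.sqrt (4 * x ^ 3 - L.g₂.re * x - L.g₃.re))⁻¹ : ℝ) : ℂ)) = -L.weierstrassZeta ((L.minRealPeriod / 2 : ℝ) : ℂ) := by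
  intro L h hdisc
  set e₁ := L.weierstrassPRe (L.minRealPeriod / 2) with he₁_def
  set A := L.g₂.re with hA
  set B := L.g₃.re with hB
  have hΩ := h.minRealPeriod_pos
  have he₁ : 4 * e₁ ^ 3 - A * e₁ - B = 0 := h.cubic_weierstrassPRe_half
  have hright : ∀ x, e₁ < x → 0 < 4 * x ^ 3 - A * x - B := fun x hx ↦ h.cubic_pos_of_lt hx
  -- the rotated lattice `iΛ` and the half-period `w = iΩ₀'/2`
  set L' := L.mulLeft I I_ne_zero with hL'
  have h' : L'.IsReal := h.mulLeft_I
  have hΩ' := h'.minRealPeriod_pos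
  set w : ℂ := I * ((L'.minRealPeriod / 2 : ℝ) : ℂ) with hw
  have h2w : 2 * w ∈ L.lattice := by
    have h1 : (L'.minRealPeriod : ℂ) ∈ L'.lattice := h'.minRealPeriod_mem_lattice
    rw [hL', PeriodPair.mem_mulLeft_lattice, Complex.inv_I] at h1
    have := neg_mem h1
    convert this using 1
    rw [hw]; push_cast; ring
  have hcw : conj w = -w := by
    rw [hw, map_mul, Complex.conj_I, Complex.conj_ofReal]; ring
  have hw_notMem : w ∉ L.lattice := by
    intro hwmem
    have h1 : I * w ∈ L'.lattice := PeriodPair.mul_mem_mulLeft_lattice.mpr hwmem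
    have h2 : ((L'.minRealPeriod / 2 : ℝ) : ℂ) ∈ L'.lattice := by
      have := neg_mem h1
      rw [hw, ← mul_assoc, Complex.I_mul_I] at this
      simpa using this
    have := h'.minRealPeriod_le ⟨by positivity, h2⟩
    linarith
  have hPw : (℘[L] w).re = -L'.weierstrassPRe (L'.minRealPeriod / 2) := by
    rw [hw, PeriodPair.weierstrassP_I_mul, Complex.neg_re]
    rfl
  have hleft : ∀ x, x < (℘[L] w).re → 4 * x ^ 3 - A * x - B < 0 := by
    intro x hx
    rw [hPw] at hx
    exact h.cubic_neg_of_lt hx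
  by_cases hcase : w + ((L.minRealPeriod / 2 : ℝ) : ℂ) ∈ L.lattice
  · -- rhombic case: `℘(w) = ℘(-Ω₀/2) = e₁` is the only real root of `f`; impossible
    exfalso
    have hPw' : (℘[L] w).re = e₁ := by
      have := L.weierstrassP_sub_coe w ⟨_, hcase⟩
      rw [Subtype.coe_mk, show w - (w + ((L.minRealPeriod / 2 : ℝ) : ℂ)) =
        -((L.minRealPeriod / 2 : ℝ) : ℂ) by ring, PeriodPair.weierstrassP_neg] at this
      rw [← this]
      rfl
    have honly : ∀ r, 4 * r ^ 3 - A * r - B = 0 → r = e₁ := by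
      intro r hr
      rcases lt_trichotomy r e₁ with hlt | heq | hgt
      · have := hleft r (by rw [hPw']; exact hlt)
        rw [hr] at this
        exact absurd this (lt_irrefl 0)
      · exact heq
      · have := hright r hgt
        rw [hr] at this
        exact absurd this (lt_irrefl 0)
    have hD : 0 < A - 3 * e₁ ^ 2 := by
      rw [PeriodPair.cubic_discr_eq_of_root he₁] at hdisc
      exact pos_of_mul_pos_left hdisc (sq_nonneg _)
    set s := Real.sqrt (A - 3 * e₁ ^ 2) with hs
    have hs2 : s ^ 2 = A - 3 * e₁ ^ 2 := Real.sq_sqrt hD.le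
    have hs0 : 0 < s := Real.sqrt_pos.mpr hD
    have hr₁ : 4 * ((-e₁ + s) / 2) ^ 3 - A * ((-e₁ + s) / 2) - B = 0 := by
      rw [PeriodPair.cubic_eq_mul_of_root he₁]
      have : 4 * ((-e₁ + s) / 2) ^ 2 + 4 * e₁ * ((-e₁ + s) / 2) + (4 * e₁ ^ 2 - A) = 0 := by
        linear_combination hs2
      rw [this, mul_zero]
    have hr₂ : 4 * ((-e₁ - s) / 2) ^ 3 - A * ((-e₁ - s) / 2) - B = 0 := by
      rw [PeriodPair.cubic_eq_mul_of_root he₁]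
      have : 4 * ((-e₁ - s) / 2) ^ 2 + 4 * e₁ * ((-e₁ - s) / 2) + (4 * e₁ ^ 2 - A) = 0 := by
        linear_combination hs2
      rw [this, mul_zero]
    have h1 := honly _ hr₁
    have h2 := honly _ hr₂
    linarith
  · -- rectangular case: the line `w + ℝ` misses `Λ`
    have hline : ∀ t : ℝ, w + t ∉ L.lattice := by
      intro t ht
      have hct : -w + t ∈ L.lattice := by
        have := h _ ht
        rwa [map_add, hcw, Complex.conj_ofReal] at this
      have h2t : ((2 * t : ℝ) : ℂ) ∈ L.lattice := by
        convert add_mem ht hct using 1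
        push_cast; ring
      obtain ⟨k, hk⟩ := h.exists_eq_int_mul h2t
      have hzmul : ∀ j : ℤ, ((j : ℝ) : ℂ) * (L.minRealPeriod : ℂ) ∈ L.lattice := by
        intro j
        have := zsmul_mem h.minRealPeriod_mem_lattice j
        rw [zsmul_eq_mul] at this
        exact_mod_cast this
      rcases Int.even_or_odd k with ⟨j, rfl⟩ | ⟨j, rfl⟩
      · have ht' : t = j * L.minRealPeriod := by push_cast at hk; linarith
        have htmem : (t : ℂ) ∈ L.lattice := by
          rw [ht']; push_cast
          exact_mod_cast hzmul j
        exact hw_notMem (by simpa using sub_mem ht htmem)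
      · have ht' : t = j * L.minRealPeriod + L.minRealPeriod / 2 := by push_cast at hk; linarith
        refine hcase ?_
        convert sub_mem ht (hzmul j) using 1
        rw [ht']; push_cast; ring
    obtain ⟨m, M, hmM, hfm, hfM, hfpos, hint⟩ :=
      exists_Ioo_integral_mul_eq_of_line h h2w hcw hline
    rw [setOf_cubic_pos_lt_eq_Ioo_of_roots h hdisc hmM hfm hfM hfpos, hint]
    exact weierstrassZeta_sub_weierstrassZeta_add_half h h2w

end Summit.KontsevichZagierPeriods.IsogenyCertificates.XMapKernelStubs.EtaIndependence

end
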